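import Mathlib
import Summits.NavierStokesRegularity.NavierStokesRegularity.Theorems.EulerZoomLiouvillePowerGaugeEulerLiouvilleSelfSimilarSubdriftLoc
import Summits.NavierStokesRegularity.NavierStokesRegularity.Theorems.EulerZoomLiouvillePowerGaugeEulerLiouvilleSelfSimilarUniformlyContinuousLoc
import Literature.Analysis.FluidPDE.HarmonicBallMeanValue
import Literature.Analysis.FluidPDE.FlatSwirlGauge
import HarnessLib.Audit

/-!
# Rung C1 of the crux `EulerZoomLiouville.PowerGaugeEulerLiouville` (sub-stratum W3b): A `C²` SELF-SIMILAR EULER PROFILE SLOWER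
# THAN THE SIMILARITY DRIFT AT INFINITY IS AFFINE — and the member vanishes

Route №10 `EulerZoomLiouville` (NavierStokesRegularity), crux E = stmt-NavierStokesRegularity-19832, tenure rung C1,
registered residue `stub_selfSimilarExtremalRest`, sub-stratum W3b.  Lineage ns-typeII-p1 (gen 8).  Sequel to
`…SelfSimilarSubdriftLoc` (`Loc.curl_eq_zero_of_subdrift`: a `C²` profile of CIV (3.3) with `0 < γ < ½` and `‖U(y)‖ ≤ κ‖y‖`
near infinity, `κ < γ`, is irrotational) and `…SelfSimilarSublinearLoc` (`o(|y|)` ⇒ constant).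

An irrotational incompressible `C²` field is harmonic componentwise; under LINEAR growth `|h(y)| ≤ A + κ‖y‖` a harmonic
function has BOUNDED GRADIENT — the tree's interior gradient estimate on a ball (`abs_fderiv_apply_le_of_laplacian_eq_zero`,
Gilbarg–Trudinger Thm 2.10) rescaled to radius `R ≍ A + κ‖y‖` by the dilation invariance of the Laplacian
(`laplacian_comp_smul_eq`) — and bounded first differences, which are bounded harmonic functions, hence constant
(`HarmonicOnNhd.apply_eq_apply_of_abs_le`): the function is AFFINE.  Hence:

* `exists_norm_fderiv_le_of_laplacian_eq_zero_of_linearGrowth` — `h : ℝ³ → ℝ` of class `C²`, `Δh = 0`,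
  `|h(y)| ≤ A + κ‖y‖` ⇒ `‖Dh‖ ≤ K`; `exists_norm_fderiv_le_of_harmonic_linearGrowth` — the same for fields `ℝ³ → ℝ³`;
* **`exists_norm_fderiv_le_of_subdrift`**, **`add_sub_eq_of_subdrift`**, **`exists_clm_of_subdrift`** — `(U, P)` a
  self-similar Euler profile (CIV (3.3)), `0 < γ < ½`, `‖U y‖ ≤ κ‖y‖` for `‖y‖ ≥ R₁` with `κ < γ`
  (`limsup_{|y|→∞} ‖U(y)‖/‖y‖ < γ`) ⇒ `DU` is bounded, `U(x + e) − U(x) = U(e) − U(0)`, and `U = U(0) + L` for a continuous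
  linear `L`: **the profile is AFFINE** (the linear strains `U = Ay`, BS15 (1.9), show nothing more can be said at profile
  level; `o(|y|)` profiles are the constants, `Loc.eq_const_of_sublinear`);
* **`selfSimilar_ae_eq_zero_of_subdriftC2_profile`** — MEMBER LEVEL, crux hypotheses verbatim, window `0 < ρ ≤ ½`, exact
  self-similarity: if `V ∈ C²` and `‖V y‖ ≤ κ‖y‖` near infinity for some `κ < 1/(2+ρ) = γ`, then `u = 0` a.e. (bounded
  gradient ⇒ `Loc.selfSimilar_ae_eq_zero_of_boundedGradientC2_profile`).  This contains the `o(|y|)` stratum (p589751) and,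
  via the `A`-gauge, the uniformly continuous one (p590088).

WHAT THIS IS NOT: not NS, not E, not rung C1 — `C²` profiles with `limsup ‖U(y)‖/‖y‖ ≥ γ` (sparse fast spikes), the weak
class (`V ∉ C²`) and all non-self-similar members remain. [folklore; GilbargTrudinger2001 Thm 2.10 (interior gradient
estimate), Thm 2.1; BronziShvydkoy2015 §1 (1.9)]
-/

noncomputable section

-- flat `Theorems/<Route><Decl>…` files of one crux share the namespace of the crux (tree convention)
set_option linter.dupNamespace false

open MeasureTheory Set Filter Topology Metric Function InnerProductSpace
open scoped RealInnerProductSpace NNReal ENNReal ContDiff Laplacian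

namespace Summit.NavierStokesRegularity.NavierStokesRegularity.Theorems.PowerGaugeEulerLiouville.Loc

open Literature.Analysis Literature.Analysis.FluidPDE
open Summit.NavierStokesRegularity.NavierStokesRegularity.Theorems.PowerGaugeEulerLiouville.Kelvin

variable {γ : ℝ} {U : EuclideanSpace ℝ (Fin 3) → EuclideanSpace ℝ (Fin 3)} {P : EuclideanSpace ℝ (Fin 3) → ℝ}

/-! ### Harmonic functions of linear growth have bounded gradient -/

/-- **Gradient bound for harmonic functions of linear growth** (`ℝ³`): if `h ∈ C²`, `Δh = 0` everywhere and
`|h(y)| ≤ A + κ‖y‖` (`κ ≥ 0`), then `‖Dh(y)‖ ≤ K` for all `y`, with `K = M₁₂ · |B̄₂| · (1 + 2κ)` (`M₁₂` the gradient bound of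
the radial weight `λ^{1,2}`).  Proof: the interior gradient estimate `|Dg(0) a| ≤ ‖a‖ M₁₂ ∫_{B̄(0,2)} |g|` applied to the
rescaled function `g(z) = h(y + Rz)` (harmonic by dilation/translation invariance of `Δ`), with `R = A + κ‖y‖ + 1`.
[cite: GilbargTrudinger2001, Thm 2.10 (interior derivative estimate, rescaled)] -/
theorem exists_norm_fderiv_le_of_laplacian_eq_zero_of_linearGrowth {h : EuclideanSpace ℝ (Fin 3) → ℝ}
    (hh : ContDiff ℝ 2 h) (hΔ : ∀ x, (Δ h) x = 0) {A κ : ℝ} (hκ : 0 ≤ κ)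
    (hgr : ∀ y, |h y| ≤ A + κ * ‖y‖) :
    ∃ K : ℝ, ∀ y, ‖fderiv ℝ h y‖ ≤ K := by
  obtain ⟨M, hM0, hM⟩ := exists_bound_fderiv_newtonFarLaplacian one_pos (by norm_num : (1 : ℝ) < 2)
  have hA0 : 0 ≤ A := by have := hgr 0; simp at this; linarith [abs_nonneg (h 0)]
  set v₂ : ℝ := (volume : Measure (EuclideanSpace ℝ (Fin 3))).real (closedBall (0 : EuclideanSpace ℝ (Fin 3)) 2) with hv₂
  have hv₂0 : 0 ≤ v₂ := measureReal_nonneg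
  refine ⟨M * v₂ * (1 + 2 * κ), fun y => ?_⟩
  refine ContinuousLinearMap.opNorm_le_bound _ (by positivity) fun a => ?_
  -- the scale
  set R : ℝ := A + κ * ‖y‖ + 1 with hRdef
  have hR : 0 < R := by rw [hRdef]; positivity
  -- the rescaled function `g z = h (y + R z)`
  set g : EuclideanSpace ℝ (Fin 3) → ℝ := fun z => h (y + R • z) with hgdef
  have hg2 : ContDiff ℝ 2 g := hh.comp (contDiff_const.add (contDiff_id.const_smul R))
  have hΔg : ∀ w ∈ ball (0 : EuclideanSpace ℝ (Fin 3)) 3, (Δ g) w = 0 := by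
    intro w _
    have h1 : (Δ g) w = R ^ 2 • (Δ (fun z => h (y + z))) (R • w) :=
      laplacian_comp_smul_eq (fun z => h (y + z)) R w
    rw [h1, laplacian_comp_const_add h y (R • w), hΔ, smul_zero]
  have hgrad := abs_fderiv_apply_le_of_laplacian_eq_zero one_pos (by norm_num : (1 : ℝ) < 2) hg2
    (y := 0) (ρ := 3) (by norm_num) hΔg hM a
  -- `Dg(0) a = R · Dh(y) a`
  have hφ : HasFDerivAt (fun z : EuclideanSpace ℝ (Fin 3) => y + R • z)
      (R • ContinuousLinearMap.id ℝ (EuclideanSpace ℝ (Fin 3))) 0 :=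
    ((hasFDerivAt_id (0 : EuclideanSpace ℝ (Fin 3))).const_smul R).const_add y
  have hcomp : HasFDerivAt g (R • fderiv ℝ h y) 0 := by
    have hd : HasFDerivAt h (fderiv ℝ h (y + R • (0 : EuclideanSpace ℝ (Fin 3))))
        (y + R • (0 : EuclideanSpace ℝ (Fin 3))) := ((hh.differentiable (by norm_num)) _).hasFDerivAt
    have h1 := hd.comp (0 : EuclideanSpace ℝ (Fin 3)) hφ
    have h2 : y + R • (0 : EuclideanSpace ℝ (Fin 3)) = y := by simp
    rw [h2] at h1
    have h3 : (fderiv ℝ h y).comp (R • ContinuousLinearMap.id ℝ (EuclideanSpace ℝ (Fin 3))) = R • fderiv ℝ h y := by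
      ext v; simp
    rw [h3] at h1
    exact h1
  have hDg : fderiv ℝ g 0 a = R * fderiv ℝ h y a := by
    rw [hcomp.fderiv, FunLike.coe_smul, Pi.smul_apply, smul_eq_mul]
  -- the integral of `|g|` over `B̄(0,2)`
  have hC : ∀ w ∈ closedBall (0 : EuclideanSpace ℝ (Fin 3)) 2, ‖|g w|‖ ≤ A + κ * (‖y‖ + 2 * R) := by
    intro w hw
    rw [mem_closedBall, dist_zero_right] at hw
    rw [Real.norm_eq_abs, abs_abs]
    refine (hgr (y + R • w)).trans ?_
    have h1 : ‖y + R • w‖ ≤ ‖y‖ + R * ‖w‖ := by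
      refine (norm_add_le _ _).trans ?_
      rw [norm_smul, Real.norm_of_nonneg hR.le]
    have h2 : R * ‖w‖ ≤ R * 2 := mul_le_mul_of_nonneg_left hw hR.le
    nlinarith
  have hint : ∫ w in closedBall (0 : EuclideanSpace ℝ (Fin 3)) 2, |g w| ≤ (A + κ * (‖y‖ + 2 * R)) * v₂ := by
    have h1 := norm_setIntegral_le_of_norm_le_const (μ := volume) measure_closedBall_lt_top hC
    rw [Real.norm_eq_abs] at h1
    exact (le_abs_self _).trans h1
  -- assembly
  have hkey : R * |fderiv ℝ h y a| ≤ ‖a‖ * M * ((A + κ * (‖y‖ + 2 * R)) * v₂) := by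
    have : |fderiv ℝ g 0 a| = R * |fderiv ℝ h y a| := by
      rw [hDg, abs_mul, abs_of_pos hR]
    rw [← this]
    exact hgrad.trans (mul_le_mul_of_nonneg_left hint (by positivity))
  have hratio : A + κ * (‖y‖ + 2 * R) ≤ (1 + 2 * κ) * R := by
    rw [hRdef]; nlinarith [norm_nonneg y]
  have h3 : R * |fderiv ℝ h y a| ≤ R * (M * v₂ * (1 + 2 * κ) * ‖a‖) := by
    calc R * |fderiv ℝ h y a| ≤ ‖a‖ * M * ((A + κ * (‖y‖ + 2 * R)) * v₂) := hkey
      _ ≤ ‖a‖ * M * (((1 + 2 * κ) * R) * v₂) := by gcongr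
      _ = R * (M * v₂ * (1 + 2 * κ) * ‖a‖) := by ring
  have h4 : |fderiv ℝ h y a| ≤ M * v₂ * (1 + 2 * κ) * ‖a‖ := le_of_mul_le_mul_left h3 hR
  rwa [Real.norm_eq_abs]

/-- **Gradient bound for harmonic vector fields of linear growth** (`ℝ³ → ℝ³`, componentwise). [cite: GilbargTrudinger2001, Thm 2.10] -/
theorem exists_norm_fderiv_le_of_harmonic_linearGrowth {V : EuclideanSpace ℝ (Fin 3) → EuclideanSpace ℝ (Fin 3)}
    (hV : ContDiff ℝ 2 V) (hΔ : ∀ x, (Δ V) x = 0) {A κ : ℝ} (hκ : 0 ≤ κ)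
    (hgr : ∀ y, ‖V y‖ ≤ A + κ * ‖y‖) :
    ∃ K : ℝ, ∀ y, ‖fderiv ℝ V y‖ ≤ K := by
  -- componentwise bounds
  have key : ∀ i : Fin 3, ∃ K : ℝ, ∀ y (a : EuclideanSpace ℝ (Fin 3)), |fderiv ℝ V y a i| ≤ K * ‖a‖ := by
    intro i
    set η : EuclideanSpace ℝ (Fin 3) → ℝ := fun z => V z i with hη
    have hηeq : η = (EuclideanSpace.proj i : EuclideanSpace ℝ (Fin 3) →L[ℝ] ℝ) ∘ V := by funext z; rfl
    have hη2 : ContDiff ℝ 2 η := by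
      rw [hηeq]; exact (EuclideanSpace.proj i : EuclideanSpace ℝ (Fin 3) →L[ℝ] ℝ).contDiff.comp hV
    have hηΔ : ∀ z, (Δ η) z = 0 := fun z => by
      rw [hηeq, hV.contDiffAt.laplacian_CLM_comp_left, Function.comp_apply, hΔ z, map_zero]
    have hηgr : ∀ y, |η y| ≤ A + κ * ‖y‖ := fun y => by
      refine le_trans ?_ (hgr y)
      simpa [hη, Real.norm_eq_abs] using PiLp.norm_apply_le (V y) i
    obtain ⟨K, hK⟩ := exists_norm_fderiv_le_of_laplacian_eq_zero_of_linearGrowth hη2 hηΔ hκ hηgr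
    refine ⟨K, fun y a => ?_⟩
    have hD : fderiv ℝ η y = (EuclideanSpace.proj i : EuclideanSpace ℝ (Fin 3) →L[ℝ] ℝ).comp (fderiv ℝ V y) := by
      rw [hηeq]
      exact ((EuclideanSpace.proj i : EuclideanSpace ℝ (Fin 3) →L[ℝ] ℝ).hasFDerivAt.comp y
        ((hV.differentiable (by norm_num)) y).hasFDerivAt).fderiv
    have h1 : fderiv ℝ V y a i = fderiv ℝ η y a := by rw [hD]; rfl
    rw [h1, ← Real.norm_eq_abs]
    exact (fderiv ℝ η y).le_of_opNorm_le (hK y) a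
  choose K hK using key
  set Km : ℝ := ∑ i, |K i| with hKm
  have hKi : ∀ i, K i ≤ Km := fun i =>
    (le_abs_self _).trans (Finset.single_le_sum (f := fun j => |K j|) (fun j _ => abs_nonneg _) (Finset.mem_univ i))
  have hKm0 : 0 ≤ Km := Finset.sum_nonneg fun j _ => abs_nonneg _
  refine ⟨2 * Km, fun y => ContinuousLinearMap.opNorm_le_bound _ (by positivity) fun a => ?_⟩
  have hcomp : ∀ i, ‖fderiv ℝ V y a i‖ ^ 2 ≤ (Km * ‖a‖) ^ 2 := by
    intro i
    rw [Real.norm_eq_abs]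
    have h1 : |fderiv ℝ V y a i| ≤ Km * ‖a‖ :=
      (hK i y a).trans (mul_le_mul_of_nonneg_right (hKi i) (norm_nonneg _))
    exact pow_le_pow_left₀ (abs_nonneg _) h1 2
  rw [EuclideanSpace.norm_eq]
  calc Real.sqrt (∑ i, ‖fderiv ℝ V y a i‖ ^ 2) ≤ Real.sqrt (∑ _i : Fin 3, (Km * ‖a‖) ^ 2) :=
        Real.sqrt_le_sqrt (Finset.sum_le_sum fun i _ => hcomp i)
    _ = Real.sqrt 3 * (Km * ‖a‖) := by
        rw [Finset.sum_const, Finset.card_univ, Fintype.card_fin, nsmul_eq_mul, Nat.cast_ofNat,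
          Real.sqrt_mul' _ (sq_nonneg _), Real.sqrt_sq (by positivity)]
    _ ≤ 2 * (Km * ‖a‖) := by
        refine mul_le_mul_of_nonneg_right ?_ (by positivity)
        rw [show (2 : ℝ) = Real.sqrt 4 by rw [show (4 : ℝ) = 2 ^ 2 by norm_num, Real.sqrt_sq (by norm_num)]]
        exact Real.sqrt_le_sqrt (by norm_num)
    _ = 2 * Km * ‖a‖ := by ring

/-! ### Subdrift profiles: bounded gradient, affine -/

/-- **A `C²` self-similar Euler profile slower than the drift at infinity has BOUNDED GRADIENT** (`0 < γ < ½`,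
`‖U y‖ ≤ κ‖y‖` for `‖y‖ ≥ R₁`, `κ < γ`): it is irrotational (`curl_eq_zero_of_subdrift`), hence harmonic componentwise
(`laplacian_eq_zero_of_curl_eq_zero_of_isDivFree`), of linear growth. [folklore; GilbargTrudinger2001 Thm 2.10] -/
theorem exists_norm_fderiv_le_of_subdrift (hprof : IsSelfSimilarEulerProfile γ 0 U P)
    {κ R₁ : ℝ} (hκ : κ < γ) (hR₁ : ∀ y : EuclideanSpace ℝ (Fin 3), R₁ ≤ ‖y‖ → ‖U y‖ ≤ κ * ‖y‖)
    (hγ : 0 < γ) (hγ2 : γ < 1 / 2) : ∃ K : ℝ, ∀ y, ‖fderiv ℝ U y‖ ≤ K := by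
  have hU2 : ContDiff ℝ 2 U := hprof.contDiff_velocity
  have hcurl := curl_eq_zero_of_subdrift hprof hκ hR₁ hγ hγ2
  have hΔ := laplacian_eq_zero_of_curl_eq_zero_of_isDivFree hU2 hcurl hprof.divFree
  -- linear growth everywhere
  set R : ℝ := max R₁ 1 with hRdef
  obtain ⟨B, hB⟩ := (isCompact_closedBall (0 : EuclideanSpace ℝ (Fin 3)) R).exists_bound_of_continuousOn
    hU2.continuous.continuousOn
  have hUlin : ∀ y : EuclideanSpace ℝ (Fin 3), ‖U y‖ ≤ max B 0 + max κ 0 * ‖y‖ := by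
    intro y
    by_cases hy : ‖y‖ ≤ R
    · have h1 : ‖U y‖ ≤ B := hB y (by rwa [mem_closedBall, dist_zero_right])
      have h2 : 0 ≤ max κ 0 * ‖y‖ := mul_nonneg (le_max_right _ _) (norm_nonneg _)
      linarith [le_max_left B 0]
    · push Not at hy
      have h1 := hR₁ y ((le_max_left _ _).trans hy.le)
      have h2 : κ * ‖y‖ ≤ max κ 0 * ‖y‖ := mul_le_mul_of_nonneg_right (le_max_left _ _) (norm_nonneg _)
      linarith [le_max_right B 0]
  exact exists_norm_fderiv_le_of_harmonic_linearGrowth hU2 hΔ (le_max_right _ _) hUlin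

/-- **A `C²` SELF-SIMILAR EULER PROFILE SLOWER THAN THE DRIFT AT INFINITY IS AFFINE** (`0 < γ < ½`, `‖U y‖ ≤ κ‖y‖` for
`‖y‖ ≥ R₁`, `κ < γ`): `U(x + e) − U(x) = U(e) − U(0)` for all `x, e` (each first difference is a bounded harmonic field,
hence constant). Sharp at profile level: the linear strains are such profiles (BS15 (1.9)). [folklore; GilbargTrudinger2001 Thm 2.1, Thm 2.10] -/
theorem add_sub_eq_of_subdrift (hprof : IsSelfSimilarEulerProfile γ 0 U P)
    {κ R₁ : ℝ} (hκ : κ < γ) (hR₁ : ∀ y : EuclideanSpace ℝ (Fin 3), R₁ ≤ ‖y‖ → ‖U y‖ ≤ κ * ‖y‖)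
    (hγ : 0 < γ) (hγ2 : γ < 1 / 2) (x e : EuclideanSpace ℝ (Fin 3)) : U (x + e) - U x = U e - U 0 := by
  have hU2 : ContDiff ℝ 2 U := hprof.contDiff_velocity
  have hcurl := curl_eq_zero_of_subdrift hprof hκ hR₁ hγ hγ2
  have hΔ := laplacian_eq_zero_of_curl_eq_zero_of_isDivFree hU2 hcurl hprof.divFree
  obtain ⟨K, hK⟩ := exists_norm_fderiv_le_of_subdrift hprof hκ hR₁ hγ hγ2
  -- the first difference `D z = U (z + e) − U z`: `C²`, harmonic, bounded by `K‖e‖`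
  set D : EuclideanSpace ℝ (Fin 3) → EuclideanSpace ℝ (Fin 3) := fun z => U (z + e) - U z with hDdef
  have hsh2 : ContDiff ℝ 2 (fun z : EuclideanSpace ℝ (Fin 3) => U (z + e)) := hU2.comp (contDiff_id.add contDiff_const)
  have hD2 : ContDiff ℝ 2 D := hsh2.sub hU2
  have hDΔ : ∀ z, (Δ D) z = 0 := by
    intro z
    have h1 : (Δ D) z = (Δ (fun w : EuclideanSpace ℝ (Fin 3) => U (w + e))) z - (Δ U) z :=
      hsh2.contDiffAt.laplacian_sub hU2.contDiffAt
    rw [h1, laplacian_comp_add_const U e z, hΔ, hΔ, sub_zero]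
  have hDbd : ∀ z, ‖D z‖ ≤ K * ‖e‖ := by
    intro z
    have h := Convex.norm_image_sub_le_of_norm_fderiv_le (f := U) (s := univ)
      (fun w _ => (hU2.differentiable (by norm_num)) w) (fun w _ => hK w) convex_univ (mem_univ z) (mem_univ (z + e))
    simpa [hDdef] using h
  -- each component of `D` is a bounded harmonic function, hence constant
  have hconst : D x = D 0 := by
    ext i
    set η : EuclideanSpace ℝ (Fin 3) → ℝ := fun z => D z i with hη
    have hηeq : η = (EuclideanSpace.proj i : EuclideanSpace ℝ (Fin 3) →L[ℝ] ℝ) ∘ D := by funext z; rfl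
    have hη2 : ContDiff ℝ 2 η := by
      rw [hηeq]; exact (EuclideanSpace.proj i : EuclideanSpace ℝ (Fin 3) →L[ℝ] ℝ).contDiff.comp hD2
    have hηΔ : ∀ z, (Δ η) z = 0 := fun z => by
      rw [hηeq, hD2.contDiffAt.laplacian_CLM_comp_left, Function.comp_apply, hDΔ z, map_zero]
    have hharm : HarmonicOnNhd η univ := harmonicOnNhd_of_laplacian_eq_zero hη2 hηΔ
    have hηbd : ∀ z, |η z| ≤ K * ‖e‖ := fun z => by
      refine le_trans ?_ (hDbd z)
      simpa [hη, Real.norm_eq_abs] using PiLp.norm_apply_le (D z) i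
    exact hharm.apply_eq_apply_of_abs_le hηbd x 0
  simpa [hDdef] using hconst

/-- **Affine form**: under the same hypotheses `U = U(0) + L` for a continuous linear map `L` (a continuous additive map
of real vector spaces is linear). [folklore] -/
theorem exists_clm_of_subdrift (hprof : IsSelfSimilarEulerProfile γ 0 U P)
    {κ R₁ : ℝ} (hκ : κ < γ) (hR₁ : ∀ y : EuclideanSpace ℝ (Fin 3), R₁ ≤ ‖y‖ → ‖U y‖ ≤ κ * ‖y‖)
    (hγ : 0 < γ) (hγ2 : γ < 1 / 2) :
    ∃ L : EuclideanSpace ℝ (Fin 3) →L[ℝ] EuclideanSpace ℝ (Fin 3), ∀ y, U y = U 0 + L y := by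
  have hadd := add_sub_eq_of_subdrift hprof hκ hR₁ hγ hγ2
  have hcont : Continuous U := hprof.contDiff_velocity.continuous
  let g : EuclideanSpace ℝ (Fin 3) →+ EuclideanSpace ℝ (Fin 3) :=
    { toFun := fun y => U y - U 0
      map_zero' := sub_self _
      map_add' := fun x e => by
        have h := hadd x e
        -- `U (x + e) = U x + U e − U 0`
        have h' : U (x + e) = U x + (U e - U 0) := by rw [← h]; abel
        rw [h']; abel }
  have hg : Continuous g := hcont.sub continuous_const
  refine ⟨g.toRealLinearMap hg, fun y => ?_⟩
  have : (g.toRealLinearMap hg) y = U y - U 0 := rfl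
  rw [this]; abel

/-! ### Member level: the stratum «V ∈ C², limsup ‖V(y)‖/‖y‖ < γ» -/

/-- **THE SUBDRIFT STRATUM OF `stub_selfSimilarExtremalRest`, MEMBER LEVEL.**  Crux hypotheses verbatim, the window
`0 < ρ ≤ ½`, exact self-similarity with profile `(V, P)`: if `V ∈ C²` and `‖V y‖ ≤ κ‖y‖` for `‖y‖ ≥ R₁` with some
`κ < 1/(2+ρ)` (the profile is eventually slower than the similarity drift `γy`, `γ = 1/(2+ρ)`; bounded and `o(|y|)` profiles
are special cases), then `u = 0` a.e. on `(−∞,0) × ℝ³`: the profile has bounded gradient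
(`exists_norm_fderiv_le_of_subdrift`) and `Loc.selfSimilar_ae_eq_zero_of_boundedGradientC2_profile` applies.  Nothing on the
pressure, the far field or the stagnation set. [folklore] -/
theorem selfSimilar_ae_eq_zero_of_subdriftC2_profile {ρ : ℝ} (hρ : 0 < ρ) (hρ1 : ρ ≤ 1 / 2)
    {u : ℝ → EuclideanSpace ℝ (Fin 3) → EuclideanSpace ℝ (Fin 3)} {p : ℝ → EuclideanSpace ℝ (Fin 3) → ℝ}
    {H : ℝ → EuclideanSpace ℝ (Fin 3) → EuclideanSpace ℝ (Fin 3) →L[ℝ] EuclideanSpace ℝ (Fin 3)} {c : ℝ≥0}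
    (hsw : IsSuitableWeakSolutionOn (slab (EuclideanSpace ℝ (Fin 3)) (Iio 0) isOpen_Iio) 0 0 u p)
    (hgauge : ∀ a : ℝ, 0 < a →
      ENNReal.ofReal (a ^ (2 * ρ)) * cknA a (0 : ℝ × EuclideanSpace ℝ (Fin 3)) u +
          ENNReal.ofReal (a ^ ρ) * cknE a (0 : ℝ × EuclideanSpace ℝ (Fin 3)) H +
        ENNReal.ofReal (a ^ (2 * ρ)) * cknD a (0 : ℝ × EuclideanSpace ℝ (Fin 3)) p ≤ (c : ℝ≥0∞))
    {V : EuclideanSpace ℝ (Fin 3) → EuclideanSpace ℝ (Fin 3)} {P : EuclideanSpace ℝ (Fin 3) → ℝ}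
    (hu : ∀ τ : ℝ, τ < 0 → u τ = selfSimilarCollapse (1 / (2 + ρ)) 0 V τ)
    (hp : ∀ τ : ℝ, τ < 0 → p τ = selfSimilarCollapsePressure (1 / (2 + ρ)) 0 P τ)
    (hV : ContDiff ℝ 2 V) {κ R₁ : ℝ} (hκ : κ < 1 / (2 + ρ))
    (hR₁ : ∀ y : EuclideanSpace ℝ (Fin 3), R₁ ≤ ‖y‖ → ‖V y‖ ≤ κ * ‖y‖) :
    uncurry u =ᵐ[volume.restrict (Iio (0 : ℝ) ×ˢ (univ : Set (EuclideanSpace ℝ (Fin 3))))] 0 := by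
  have hρ1' : ρ < 1 := by linarith
  have h2ρ : (0 : ℝ) < 2 + ρ := by linarith
  have hγ : (0 : ℝ) < 1 / (2 + ρ) := one_div_pos.2 h2ρ
  have hγ2 : 1 / (2 + ρ) < 1 / 2 := one_div_lt_one_div_of_lt two_pos (by linarith)
  have hD : ∀ a : ℝ, 0 < a → ENNReal.ofReal (a ^ (2 * ρ)) *
      cknD a (0 : ℝ × EuclideanSpace ℝ (Fin 3)) p ≤ (c : ℝ≥0∞) :=
    fun a ha => le_trans le_add_self (hgauge a ha)
  have hpm : AEStronglyMeasurable (uncurry p)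
      (volume.restrict (Iio (0 : ℝ) ×ˢ (univ : Set (EuclideanSpace ℝ (Fin 3))))) := by
    have := hsw.distributional.2.2.1.aestronglyMeasurable
    simpa [slab] using this
  have hPm := aestronglyMeasurable_pressureProfile hpm hp
  have hDprof := profile_pressure_weight_of_gaugeD hρ hρ1' hpm hp hD
  have hP1 : LocallyIntegrable P volume :=
    EnergySaturation.locallyIntegrable_pressure_of_weight hρ1' hPm
      (ENNReal.mul_ne_top ENNReal.ofReal_ne_top ENNReal.coe_ne_top) hDprof
  obtain ⟨P', hprof⟩ := WeakToClassical.exists_isSelfSimilarEulerProfile_of_contDiff hsw.distributional hu hp hV hP1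
  obtain ⟨K, hK⟩ := exists_norm_fderiv_le_of_subdrift hprof hκ hR₁ hγ hγ2
  exact selfSimilar_ae_eq_zero_of_boundedGradientC2_profile hρ hρ1 hsw hgauge hu hp hV hK

end Summit.NavierStokesRegularity.NavierStokesRegularity.Theorems.PowerGaugeEulerLiouville.Loc

end
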